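import Summits.HodgeConjecture.HodgeConjecture.Theses.HeckePrymWeil
import Summits.HodgeConjecture.HodgeConjecture.Theorems.HeckePrymWeilIsoInvariance
import Summits.HodgeConjecture.HodgeConjecture.Theorems.HeckePrymWeilHeckePrymAnchorsIsogenyTransfer
import Summits.HodgeConjecture.HodgeConjecture.Theorems.HeckePrymWeilHeckePrymAnchorsPointClassAnchor
import Summits.HodgeConjecture.HodgeConjecture.Theorems.HeckePrymWeilHeckePrymAnchorsWeilSurface
import Literature.AlgebraicGeometry.Motives.AbelianVarietyProjectiveChart
import Literature.AlgebraicGeometry.Motives.AbelianVarietyProductDimProofs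
import Summits.HodgeConjecture.HodgeConjecture.Theorems.PadicSemiregularLiftHodgeAbelianVarietiesStubCmAnchoredFamilies
import Literature.AlgebraicGeometry.HodgeTheory.FermatHypersurfaceReduction
import Literature.AlgebraicGeometry.HodgeTheory.WeilClassesFourfoldsProofs
import Literature.AlgebraicGeometry.HodgeTheory.GlobalInvariantCycles
import Literature.AlgebraicGeometry.HodgeTheory.MotivatedClassesDeformationInputs
import HarnessLib

/-!
# `HeckePrymAnchors` from the line's stubs — fully hypothetical composition (item stmt-HodgeConjecture-14496, route HeckePrymWeil)

The crux `HeckePrymAnchors` of route `HeckePrymWeil` (uniform anchor supply: for every `√-p`-abelian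
`2n`-fold `(A, φ)` a Weil surface `(B, ψ)` such that every rational `(k,k)` Weil class of
`(A × B, φ × ψ)`, `k = n + 1`, is ANCHORED in a smooth projective family of `√-p`-abelian `2k`-folds
with an algebraic value at some fibre) REDUCED to four published statements, three of which are
named facts already in the tree:

* `hD : HodgeTheory.deligne_globalInvariantCycles` (Deligne, Hodge II 4.1.1 / Charles–Schnell 11.3.4);
* `hHir` : the body of `HodgeTheory.Hironaka1964_smoothCompactification` (Hironaka 1964);
* `hCS : HodgeTheory.charlesSchnell_hodgeClass_of_flat` (Charles–Schnell Prop. 11.3.5 (1));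
* `hWF` : the WEIL FAMILY WITH A FLAT WEIL SECTION AND A TENSOR-SPLIT FIBRE — the one construction the
  tree lacks (Deligne, LNM 900 I, proof of Thm 4.8, pp. 47–52: the level-`n ≥ 3` PEL family of
  polarized abelian `2k`-folds with `O_K`-action over the connected smooth quasi-projective `Γ\X⁺`;
  monodromy in `SU`, `det_K = 1`, so strong Weil classes give a continuous section of `FiberClass`;
  the diagonal CM point of van Geemen LNM 1594 5.4–5.7 / André 1996 Lemme 6.3.3 lies in every such
  family and is `K`-isogenous to the tensor point `(E_K^k ⊗_ℚ K, companion)`).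

Everything else is PROVED in the tree and assembled here: the companion Weil surface `E × E`
(`stub_weilSurface`, file `…WeilSurface`), the typing upgrade from the crux's single-operator Weil
plane to the tree's `weilClassesOf` (`stub_upgrade`, unconditional — `⋀•H¹` dictionary
`up_exteriorH1`), the global class of a flat section (`stub_globalClassOfSection`), rationality along
a flat section (`stub_rationalAlongSection`), Deligne's tensor-point anchor
(`stub_pointClassAnchor`, no dictionary) and isogeny transfer of the strong Weil plane
(`stub_isogenyTransfer`). This file is the line lead's skeleton `Cruxes/HeckePrymAnchors/Lines/Sketch.lean`
(v3) with ALL seven stubs turned into hypotheses (the three proved ones are discharged in the sequel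
`…HeckePrymAnchorsOfWeilFamily`); it introduces no definition.
-/

noncomputable section

-- every declaration of this problem lives in `Summit.HodgeConjecture.HodgeConjecture.…` (summit = sub-problem)
set_option linter.dupNamespace false

open CategoryTheory AlgebraicGeometry Limits MonoidalCategory CartesianMonoidalCategory

namespace Summit.HodgeConjecture.HodgeConjecture.Theorems.HeckePrymWeilLine

open Literature.AlgebraicGeometry Literature.AlgebraicGeometry.Motives Literature.AlgebraicGeometry.HodgeTheory
open Summit.HodgeConjecture.HodgeConjecture.Theses.HeckePrymWeil
open Summit.HodgeConjecture.HodgeConjecture.Cruxes.HodgeAbelianVarieties.SubtorusGalleryBlochSeeds.Stubs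
  (isSmoothProjectiveFamily_toUnit isIso_fiberι_toUnit unit_base)

/-- Transport of algebraicity BACK along an isomorphism onto a fibre, from the route's PROVED support
`IsoInvariance` (`Theorems.isoInvariance_proof`). [cite: Fulton1998, §19.1] -/
theorem owf_isoTransport (F : SchemeOver ℂ) (Y : AbelianVariety ℂ) (e₀ : Y.X ≅ F) (k : ℕ)
    (x : complexBetti F (2 * k)) (hx : complexBetti.map e₀.hom (2 * k) x ∈ algebraicClasses Y.X k) :
    x ∈ algebraicClasses F k := by
  have h' := Theorems.isoInvariance_proof e₀.symm k (complexBetti.map e₀.hom (2 * k) x) hx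
  have hcomp : complexBetti.map e₀.symm.hom (2 * k) (complexBetti.map e₀.hom (2 * k) x) = x := by
    rw [← CategoryTheory.comp_apply, ← complexBetti.map_comp, Iso.symm_hom, Iso.inv_hom_id,
      complexBetti.map_id, CategoryTheory.id_apply]
  rwa [hcomp] at h'

/-- `k ≥ 3` under the crux's side conditions (`7 ≤ p`, `2 ≤ g`, `k = (p-1)/2 · (g-1)`). -/
theorem owf_three_le_k {p g k : ℕ} (hp7 : 7 ≤ p) (hg : 2 ≤ g) (hkm : k = (p - 1) / 2 * (g - 1)) :
    3 ≤ k := by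
  have hm : 3 ≤ (p - 1) / 2 := by omega
  have hg1 : 1 ≤ g - 1 := by omega
  calc 3 = 3 * 1 := rfl
    _ ≤ (p - 1) / 2 * (g - 1) := Nat.mul_le_mul hm hg1
    _ = k := hkm.symm

/-- `S(ℂ)` is connected for an irreducible quasi-projective `S` (the tree's PROVED
`ComplexPoints.connectedSpace_iff_holds`). [cite: SGA1, Exp. XII Prop. 2.4] -/
theorem owf_connectedSpace_complexPoints {S : SchemeOver ℂ}
    (hSqp : IsQuasiProjectiveOver S) (hirr : IrreducibleSpace S.left) :
    ConnectedSpace (ComplexPoints S) := by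
  haveI := hirr
  haveI : LocallyOfFiniteType S.hom := hSqp.locallyOfFiniteType
  exact (ComplexPoints.connectedSpace_iff_holds S).2 inferInstance

/-! ## The `c = 0` branch: the constant family over the point (def-free, via the tree's
`isSmoothProjectiveFamily_toUnit` / `isIso_fiberι_toUnit` / `unit_base`) -/

/-- **The zero class is anchored by the constant family** `X ⟶ Spec ℂ` (`W = 0`): smooth projective
of relative dimension `2k` with every fibre `≅ X` (`isSmoothProjectiveFamily_toUnit`,
`isIso_fiberι_toUnit`), base `Spec ℂ` smooth irreducible (`unit_base`), `0` rational and — given a Hodge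
model of `X`, transported along the fibre isomorphism — of type `(k,k)`, and `0` algebraic. [folklore] -/
theorem owf_anchored_zero (p k : ℕ) (C : AbelianVariety ℂ) (φ' : C ⟶ C) (hC : C.dim = 2 * k)
    (hφ' : φ' ≫ φ' = -((p : ℤ) • 𝟙 C)) (hM : Nonempty (HodgeModel (2 * k) C.X)) :
    ∃ (𝒳 S : SchemeOver ℂ) (f : 𝒳 ⟶ S) (s₁ s₀ : ComplexPoints S) (e : C.X ≅ fiberOver f s₁)
      (W : complexBetti 𝒳 (2 * k)),
      IsSmoothProjectiveFamily f (2 * k) ∧ IrreducibleSpace S.left ∧ AlgebraicGeometry.Smooth S.hom ∧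
      (∀ s : ComplexPoints S, IsRationalClass (complexBetti.map (fiberι f s) (2 * k) W) ∧
        IsOfHodgeType (2 * k) (fiberOver f s) (2 * k) k k (complexBetti.map (fiberι f s) (2 * k) W)) ∧
      (∀ s : ComplexPoints S, ∃ (A' : AbelianVariety ℂ) (φ'' : A' ⟶ A'), A'.dim = (2 * k) ∧
        φ'' ≫ φ'' = -((p : ℤ) • 𝟙 A') ∧ Nonempty (A'.X ≅ fiberOver f s)) ∧
      complexBetti.map e.hom (2 * k) (complexBetti.map (fiberι f s₁) (2 * k) W) = 0 ∧
      complexBetti.map (fiberι f s₀) (2 * k) W ∈ algebraicClasses (fiberOver f s₀) k := by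
  have hfam : IsSmoothProjectiveFamily (CartesianMonoidalCategory.toUnit C.X) (2 * k) :=
    hC ▸ isSmoothProjectiveFamily_toUnit C
  let u : ComplexPoints (𝟙_ (SchemeOver ℂ)) := CartesianMonoidalCategory.toUnit (specOver ℂ ℂ)
  haveI := isIso_fiberι_toUnit C u
  have h0 : IsOfHodgeType (2 * k) C.X (2 * k) k k (0 : complexBetti C.X (2 * k)) :=
    IsOfHodgeType.zero hM.some _ _ _
  refine ⟨C.X, 𝟙_ (SchemeOver ℂ), CartesianMonoidalCategory.toUnit C.X, u, u,
    (asIso (fiberι (CartesianMonoidalCategory.toUnit C.X) u)).symm, 0, hfam, unit_base.2.2,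
    unit_base.2.1, fun s => ⟨?_, ?_⟩, fun s => ?_, ?_, ?_⟩
  · rw [map_zero]; exact IsRationalClass.zero
  · haveI := isIso_fiberι_toUnit C s
    exact h0.map_of_iso (asIso (fiberι (CartesianMonoidalCategory.toUnit C.X) s))
  · haveI := isIso_fiberι_toUnit C s
    exact ⟨C, φ', hC, hφ', ⟨(asIso (fiberι (CartesianMonoidalCategory.toUnit C.X) s)).symm⟩⟩
  · rw [map_zero, map_zero]
  · rw [map_zero]; exact Submodule.zero_mem _

/-- **The anchor: tensor-split varieties have algebraic strong Weil planes.** If `(Y, Ψ)` of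
dimension `2k` admits an isogeny pair `f : Y → A₁ × A₁`, `g : A₁ × A₁ → Y` (`f ≫ g = m·𝟙`,
`m ≥ 1`, `f` flat) with `g` intertwining `Ψ` and the companion endomorphism `(x, y) ↦ (-p·y, x)` of
`A₁ × A₁` (`A₁` any abelian `k`-fold), then `weilClassesOf Y Ψ k p ≤ algebraicClasses Y.X k` —
Deligne's tensor-point anchor (`stub_pointClassAnchor`) moved across the isogeny
(`stub_isogenyTransfer`). [cite: Deligne1982HodgeCycles, Lemma 4.5 and Remark 4.10] -/
theorem owf_anchorAlgebraic {p : ℕ} (hp : p.Prime) (hp4 : p % 4 = 3) (hp7 : 7 ≤ p) {k : ℕ}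
    {Y : AbelianVariety ℂ} {Ψ : Y ⟶ Y} (A₁ : AbelianVariety ℂ) (f : Y ⟶ A₁.prod A₁)
    (g : A₁.prod A₁ ⟶ Y) (m : ℕ) (hA₁ : A₁.dim = k) (hY : Y.dim = 2 * k)
    (hΨ : Ψ ≫ Ψ = -((p : ℤ) • 𝟙 Y)) (hm : 0 < m) (hfg : f ≫ g = m • 𝟙 Y)
    (hf : Flat f.hom.hom.hom.left)
    (hg : g ≫ Ψ = AbelianVariety.prodLift (AbelianVariety.snd A₁ A₁ ≫ (-((p : ℤ) • 𝟙 A₁)))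
      (AbelianVariety.fst A₁ A₁) ≫ g) :
    weilClassesOf Y Ψ k p ≤ algebraicClasses Y.X k := by
  have hdim : (A₁.prod A₁).dim = 2 * k := by rw [AbelianVariety.dim_prod, hA₁, two_mul]
  exact stub_isogenyTransfer p k Y (A₁.prod A₁) Ψ _ hY hdim hΨ f g m hm hfg hf hg
    (stub_pointClassAnchor p hp hp4 hp7 k A₁ hA₁)

/-- **`HeckePrymAnchors` from the line's seven stub statements, all as hypotheses** (`hU` = the typing upgrade
`stub_upgrade`, `hG` = `stub_globalClassOfSection`, `hR` = `stub_rationalAlongSection` — all three PROVED in the tree,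
files `…HeckePrymAnchorsUpgrade/GlobalClassOfSection/RationalAlongSection`, discharged in the sequel file
`…HeckePrymAnchorsOfWeilFamily` once their modules are importable on the farm; then the four named facts). `hD` = the named
fact `deligne_globalInvariantCycles` (partie fixe); `hHir` = the body of the named fact
`Hironaka1964_smoothCompactification`; `hCS` = the named fact `charlesSchnell_hodgeClass_of_flat`;
`hWF` = existence of the polarized `ℚ(√-p)`-Weil family through a given `√-p`-abelian `2k`-fold `X`
(embedded smooth projective family over a smooth quasi-projective irreducible base, every fibre a
`√-p`-abelian `2k`-fold) carrying, for every class `c` of the STRONG Weil plane of `X`, a continuous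
section of `FiberClass` through `c`, and a fibre `K`-isogenous to a tensor point `(A₁ × A₁, companion)`
at which the section's value lies in the strong Weil plane (Deligne LNM 900 proof of Thm 4.8; van
Geemen LNM 1594 §5; André 1996 Lemme 6.3.3). Proof: Weil surface `B := E × E` with the companion `ψ`
(`stub_weilSurface`); for a rational `(k,k)` class `c` of the crux's typed plane of `(A × B, φ × ψ)`:
upgrade to the strong plane (`stub_upgrade`), take the family and section of `hWF`, globalise the
section to a class `W` of the total space (`stub_globalClassOfSection` from `hD`, `hHir`), propagate
rationality (`stub_rationalAlongSection`) and Hodge type (`hCS`) along it, and read algebraicity at the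
tensor-split fibre from `owf_anchorAlgebraic` through the fibre isomorphism (`IsoInvariance`).
[cite: Deligne1982HodgeCycles, proof of Thm. 4.8] [cite: vanGeemen1994HodgeAV, §5.3–5.11]
[cite: Andre1996Motifs, Lemme 6.3.3] -/
theorem heckePrymAnchors_of_stubs :
    (∀ p : ℕ, p.Prime → p % 4 = 3 → 7 ≤ p → ∀ (k : ℕ) (X : AbelianVariety ℂ) (Φ : X ⟶ X), X.dim = 2 * k → Φ ≫ Φ = -((p : ℤ) • 𝟙 X) → Module.End.eigenspace (complexBetti.map (𝟙 X + Φ).hom.hom.hom (2 * k)).hom ((1 + Complex.I * (Real.sqrt (p : ℝ) : ℂ)) ^ (2 * k)) ⊔ Module.End.eigenspace (complexBetti.map (𝟙 X + Φ).hom.hom.hom (2 * k)).hom ((1 - Complex.I * (Real.sqrt (p : ℝ) : ℂ)) ^ (2 * k)) ≤ weilClassesOf X Φ k p) →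
    (deligne_globalInvariantCycles → (∀ (m : ℕ) (T : SchemeOver ℂ), SmoothOfRelativeDimension m T.hom → IsQuasiProjectiveOver T → IrreducibleSpace T.left → ∃ (Tbar : SchemeOver ℂ) (i : T ⟶ Tbar), IsSmoothProjective m Tbar ∧ IsOpenImmersion i.left) → ∀ ⦃𝒳 S : SchemeOver ℂ⦄ (f : 𝒳 ⟶ S) (n k : ℕ), IsSmoothProjectiveFamily f n → (∃ (N : ℕ) (ι : 𝒳 ⟶ projectiveSpace N ℂ ⊗ S), IsClosedImmersion ι.left ∧ ι ≫ snd (projectiveSpace N ℂ) S = f) → AlgebraicGeometry.Smooth S.hom → IsQuasiProjectiveOver S → IrreducibleSpace S.left → ∀ (σ : ComplexPoints S → FiberClass f k), Continuous σ → (∀ s, (σ s).pt = s) → ∃ W : complexBetti 𝒳 k, ∀ s, σ s = globalSection f k W s) →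
    (∀ ⦃𝒳 S : SchemeOver ℂ⦄ (f : 𝒳 ⟶ S) (n k : ℕ), IsSmoothProjectiveFamily f n → AlgebraicGeometry.Smooth S.hom → IsQuasiProjectiveOver S → IrreducibleSpace S.left → ∀ (σ : ComplexPoints S → FiberClass f k), Continuous σ → (∀ s, (σ s).pt = s) → ∀ s₁ : ComplexPoints S, IsRationalClass (σ s₁).cls → ∀ s, IsRationalClass (σ s).cls) →
    (deligne_globalInvariantCycles) →
    (∀ (m : ℕ) (T : SchemeOver ℂ), SmoothOfRelativeDimension m T.hom → IsQuasiProjectiveOver T → IrreducibleSpace T.left → ∃ (Tbar : SchemeOver ℂ) (i : T ⟶ Tbar), IsSmoothProjective m Tbar ∧ IsOpenImmersion i.left) →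
    (charlesSchnell_hodgeClass_of_flat) →
    (∀ p : ℕ, p.Prime → p % 4 = 3 → 7 ≤ p → ∀ (k : ℕ), 1 ≤ k → ∀ (X : AbelianVariety ℂ) (Φ : X ⟶ X), X.dim = 2 * k → Φ ≫ Φ = -((p : ℤ) • 𝟙 X) → ∀ c : complexBetti X.X (2 * k), c ∈ weilClassesOf X Φ k p → c ≠ 0 → IsRationalClass c → IsOfHodgeType (2 * k) X.X (2 * k) k k c → ∃ (𝒳 S : SchemeOver ℂ) (f : 𝒳 ⟶ S) (s₁ s₀ : ComplexPoints S) (e : X.X ≅ fiberOver f s₁) (σ : ComplexPoints S → FiberClass f (2 * k)), IsSmoothProjectiveFamily f (2 * k) ∧ (∃ (N : ℕ) (ι : 𝒳 ⟶ projectiveSpace N ℂ ⊗ S), IsClosedImmersion ι.left ∧ ι ≫ snd (projectiveSpace N ℂ) S = f) ∧ IrreducibleSpace S.left ∧ AlgebraicGeometry.Smooth S.hom ∧ IsQuasiProjectiveOver S ∧ (∀ s : ComplexPoints S, ∃ (A' : AbelianVariety ℂ) (φ' : A' ⟶ A'), A'.dim = 2 * k ∧ φ' ≫ φ' = -((p :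 ℤ) • 𝟙 A') ∧ Nonempty (A'.X ≅ fiberOver f s)) ∧ Continuous σ ∧ (∀ s, (σ s).pt = s) ∧ σ s₁ = ⟨s₁, complexBetti.map e.inv (2 * k) c⟩ ∧ ∃ (Y : AbelianVariety ℂ) (Ψ : Y ⟶ Y) (e₀ : Y.X ≅ fiberOver f s₀) (x : complexBetti (fiberOver f s₀) (2 * k)), (∃ (A₁ : AbelianVariety ℂ) (f₁ : Y ⟶ A₁.prod A₁) (g₁ : A₁.prod A₁ ⟶ Y) (m : ℕ), A₁.dim = k ∧ Y.dim = 2 * k ∧ Ψ ≫ Ψ = -((p : ℤ) • 𝟙 Y) ∧ 0 < m ∧ f₁ ≫ g₁ = m • 𝟙 Y ∧ Flat f₁.hom.hom.hom.left ∧ g₁ ≫ Ψ = AbelianVariety.prodLift (AbelianVariety.snd A₁ A₁ ≫ (-((p : ℤ) • 𝟙 A₁))) (AbelianVariety.fst A₁ A₁) ≫ g₁) ∧ σ s₀ = ⟨s₀, x⟩ ∧ complexBetti.map e₀.hom (2 * k) x ∈ weilClassesOf Y Ψ k p) →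
    Summit.HodgeConjecture.HodgeConjecture.Theses.HeckePrymWeil.HeckePrymAnchors := by
  intro hU hG hR hD hHir hCS hWF p hp hp4 hp7 g hg n k hk hkm A φ hA hφ
  obtain ⟨B, ψ, hBW⟩ := stub_weilSurface p hp hp4 hp7
  refine ⟨B, ψ, hBW.1, hBW.2.1, hBW.2.2, ?_⟩
  intro c hrat hH hW
  have hk1 : 1 ≤ k := by have := owf_three_le_k hp7 hg hkm; omega
  -- the product `X = A × B` with `Φ = φ × ψ`
  have hX : (A.prod B).dim = 2 * k := by
    rw [AbelianVariety.dim_prod, hA, hBW.1]; omega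
  have hφ' : φ ≫ φ = -(p • 𝟙 A) := by rw [hφ, natCast_zsmul]
  have hψ' : ψ ≫ ψ = -(p • 𝟙 B) := by rw [hBW.2.1, natCast_zsmul]
  have hΦ : AbelianVariety.prodLift (AbelianVariety.fst A B ≫ φ) (AbelianVariety.snd A B ≫ ψ) ≫
      AbelianVariety.prodLift (AbelianVariety.fst A B ≫ φ) (AbelianVariety.snd A B ≫ ψ) =
      -((p : ℤ) • 𝟙 (A.prod B)) := by
    rw [prodLift_comp_self_eq_neg_nsmul hφ' hψ', natCast_zsmul]
  -- the zero class: constant family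
  by_cases h0 : c = 0
  · subst h0
    exact owf_anchored_zero p k (A.prod B) _ hX hΦ ⟨hH.choose⟩
  -- typing upgrade, then the Weil family with its flat section
  have hcW := hU p hp hp4 hp7 k (A.prod B) _ hX hΦ hW
  obtain ⟨𝒳, S, f, s₁, s₀, e, σ, hfam, hι, hirr, hsm, hSqp, hfib, hσ, hpt, hs₁, Y, Ψ, e₀, x,
    ⟨A₁, f₁, g₁, m, hA₁, hY, hΨ, hm, hfg, hf, hg⟩, hs₀, hx⟩ :=
    hWF p hp hp4 hp7 k hk1 (A.prod B) _ hX hΦ c hcW h0 hrat hH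
  -- the global class of the section (partie fixe + Hironaka)
  obtain ⟨W, hWσ⟩ := hG hD hHir f (2 * k) (2 * k) hfam hι hsm hSqp hirr σ hσ hpt
  have hcls : ∀ (s : ComplexPoints S) (y : complexBetti (fiberOver f s) (2 * k)),
      σ s = ⟨s, y⟩ → complexBetti.map (fiberι f s) (2 * k) W = y := by
    intro s y hy
    have h := (hWσ s).symm.trans hy
    simp only [globalSection, FiberClass.mk.injEq, heq_eq_eq, true_and] at h
    exact h
  have hW₁ : complexBetti.map (fiberι f s₁) (2 * k) W = complexBetti.map e.inv (2 * k) c := hcls s₁ _ hs₁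
  have hW₀ : complexBetti.map (fiberι f s₀) (2 * k) W = x := hcls s₀ x hs₀
  -- rationality along the section, Hodge type by Charles–Schnell
  have hrat₁ : IsRationalClass (σ s₁).cls := by
    rw [hs₁]; exact hrat.map _
  have hratσ : ∀ s, IsRationalClass (σ s).cls :=
    hR f (2 * k) (2 * k) hfam hsm hSqp hirr σ hσ hpt s₁ hrat₁
  have hconn : ConnectedSpace (ComplexPoints S) := owf_connectedSpace_complexPoints hSqp hirr
  have hloc₁ : σ s₁ ∈ locusOfHodgeClasses f (2 * k) k := by
    rw [hs₁, mem_locusOfHodgeClasses_iff]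
    exact ⟨hrat.map _, hH.map_of_iso e.symm⟩
  have hlocσ : ∀ s, σ s ∈ locusOfHodgeClasses f (2 * k) k :=
    hCS 𝒳 S f (2 * k) k hfam hSqp hsm hconn σ hσ hpt hratσ s₁ hloc₁
  have hfibre : ∀ s : ComplexPoints S, IsRationalClass (complexBetti.map (fiberι f s) (2 * k) W) ∧
      IsOfHodgeType (2 * k) (fiberOver f s) (2 * k) k k (complexBetti.map (fiberι f s) (2 * k) W) := by
    intro s
    have h := hlocσ s
    rw [hWσ s, mem_locusOfHodgeClasses_iff] at h
    exact h
  -- assemble the anchoring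
  refine ⟨𝒳, S, f, s₁, s₀, e, W, hfam, hirr, hsm, hfibre, hfib, ?_, ?_⟩
  · rw [hW₁, ← CategoryTheory.comp_apply, ← complexBetti.map_comp, Iso.hom_inv_id, complexBetti.map_id]
    rfl
  · rw [hW₀]
    exact owf_isoTransport _ Y e₀ k x
      (owf_anchorAlgebraic hp hp4 hp7 A₁ f₁ g₁ m hA₁ hY hΨ hm hfg hf hg hx)

end Summit.HodgeConjecture.HodgeConjecture.Theorems.HeckePrymWeilLine

end
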